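/-
Copyright: cell pub-balaban-gaps (YM BLITZ Y1, track G1), seat g1-p2 GEN 4 (unit `pub-balaban-gaps-g1-p2`).  Row (D4) NODE O,
OBJECT ∕ MECHANISM level: the FIRST inhabitant of the SMALL-ACROSS form `ExistsUniformAcrossSmall` (the row's typed first missing
lemma, `B13TermWalkDataOneTorus` p352181 ✓) whose constant package is TORUS-UNIFORM by a row sum and whose Γ-kernel slot is a
GENUINE (σ- and u-dependent) local kernel family (`B13LocalKernelWalks`), across an exhausting family of tori of bounded dimension;
precision ∕ covariance slots free.  HONEST FRAMING: a MODEL family; nothing of Bałaban's constructed or asserted; (D4) NOT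
discharged (instance 0∕1); NOT BetaPertH, NOT continuum, NOT Clay.
-/
import Literature.MathematicalPhysics.QuantumFieldTheory.Balaban1983to89.B13LocalKernelWalks
import Literature.MathematicalPhysics.QuantumFieldTheory.Balaban1983to89.B13TermWalkDataOneTorus

/-!
# `Gaps.D4WalkModelAcross` — (v)⁺ `ExistsUniformAcrossSmall` INHABITED ACROSS ALL TORI by local Γ-kernel data with a
# torus-uniform package (cell pub-balaban-gaps, seat g1-p2 gen 4)

HONEST DEPENDENCY (cell pub-balaban, verbatim): continuum YM on T⁴ ⇐ BetaPertH ∧ nine spine estimates (0/9 proved);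
BetaPertH ⇐ (D1) ∧ (D4) ∧ CAP+tail.

WHERE THIS SITS.  Row (D4)'s first missing lemma at NODE O is typed as `B13TermWalkDataOneTorus.ExistsUniformAcrossSmall 𝓣 α Rσ₀ θ₀`
(ONE admissible AND SMALL constant package `w` serving every member of the exhausting family of tori ∕ scales and every
(2.14)-term of it) for BAŁABAN's family `𝓣`.  The tree's inhabitants so far are DEGENERATE: the free term (`termWalkData_free`,
kernels `0` and `1`) and, on ONE torus, bounded-analytic JUNK (`existsWalkDataUniform_junk`, `K̄ ∝ e^{κ·diam T}`, which FAILS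
`SmallTheta` — g1-plan-2 X-11).  THIS FILE builds the first family of MODEL term kernels whose Γ-kernel slot is a genuine local
kernel family (σ-monomials, coefficients analytic in the configuration — `B13LocalKernelWalks.LocalTerms`) and proves
`ExistsUniformAcrossSmall` for it ACROSS EVERY FAMILY OF TORI sharing the locality letters `(R, λ, r, m_J, n_B)` and ONE row-sum
constant `c_μ` (for tori of dimension `≤ d_m`: `c_μ = c₀(1,μ)^{d_m}`, `B13LocalKernelWalks.rowSum_torus_of_le`) — the package
`w = (R, ε, κ, K̄_Γ, 1, 1, Rσ₀)` with `K̄_Γ = λe^{κ₁m_J}e^{ρr}·n_B·c_μ` is TORUS-INDEPENDENT, so `SmallTheta` holds as soon as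
`2·max(K̄_Γ,1)·(e^{−εRσ₀} + α∕R) ≤ θ₀`: smallness by GENUINE decay letters, not by a diameter.
* §1 `ModelTerm` ∕ `ModelTerm.toKernels` — a `TermKernels` record with FREE precision `A = 1` (so `C = 1 ≻ 0`) and Γ-kernel the
  kernel of a local datum `L` whose reference value `L.kernel 0 0` is real (`hreal`);
* §2 `ModelTerm.termWalkData` — `TermWalkData` for it with the package above (Γ-slot: `jointWalkExpansion_local`; precision and
  covariance slots: the identity's one-term expansions);
* §3 `ModelMember` ∕ `acrossSmall_model` — (v)⁺ across ANY index of members; `acrossSmall_model_dim` — tori of dimension `≤ d_m`,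
  row sum discharged.
WHAT IT DOES NOT DO: the σ-content of (2.16) (`θ_σ ∝ e^{−εR_σ}` from walks of LENGTH `≥ R_σ`) needs multi-step walks, i.e. the
Neumann step of the calculus ([B9] (3.130); ne5's T9 `Spine/NE5/Neumann*` at the `WalkMajorants` level) — a one-step Γ-kernel
far from `X` (`hfar`) carries σ only on terms of range `≥ R_σ`; the precision slot here is free.  Nothing about Bałaban's
`Γ_k(Z₀,σ,𝐔,𝐉)`, `Δ^{(k)}`, `C^{(k)}`; words of row (D4) UNCHANGED; (D4) instance 0∕1.
-/

noncomputable section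

namespace Summit.QuantumFields.BalabanUV.Gaps.D4WalkModelAcross

open Metric Set Finset
open Literature.MathematicalPhysics.QuantumFieldTheory.Balaban1983to89
open Literature.MathematicalPhysics.QuantumFieldTheory.Balaban1983to89.B9SectDWalk (Through MajSumLe)
open Literature.MathematicalPhysics.QuantumFieldTheory.Balaban1983to89.B9Thm34Ext (toB6)
open Literature.MathematicalPhysics.QuantumFieldTheory.Balaban1983to89.B9Thm37GlueTorus
  (torusGeom tdist1 tdist1_nonneg tdist1_self)
open Literature.MathematicalPhysics.QuantumFieldTheory.Balaban1983to89.TreeLengthTorus (TPt)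
open Literature.MathematicalPhysics.QuantumFieldTheory.Balaban1983to89.B5TorusCover (UT)
open Literature.MathematicalPhysics.QuantumFieldTheory.Balaban1983to89.B11SectG (RowSum)
open Literature.MathematicalPhysics.QuantumFieldTheory.Balaban1983to89.B13JointWalkExpansion (JointWalkExpansion WalkMajorants)
open Literature.MathematicalPhysics.QuantumFieldTheory.Balaban1983to89.B13TermWalkData
  (WalkConsts TermKernels TermWalkData TorusTerms)
open Literature.MathematicalPhysics.QuantumFieldTheory.Balaban1983to89.B13TermWalkDataOneTorus
  (SmallTheta ExistsUniformAcrossSmall acrossSmall_of_decay)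
open Literature.MathematicalPhysics.QuantumFieldTheory.Balaban1983to89.B13LocalKernelWalks (LocalTerms)

/-! ## §1. The model term kernels: free precision, local Γ-kernel -/

section Model

variable {d N' : ℕ} {ν : ℕ} {Nf : Fin ν → ℕ} [∀ i, NeZero (Nf i)]
variable {E : Type*} [NormedAddCommGroup E] [NormedSpace ℂ E]

/-- MODEL TERM DATUM (Type-valued, nothing asserted): row bonds `Λ` and extra columns `C₀` located on the site torus, the
σ-region `X`, the fibre bound `m`, and a LOCAL DATUM `L` (`B13LocalKernelWalks.LocalTerms`) for the Γ-kernel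
`Λ × (Λ ⊕ C₀)` whose reference value at `(σ,u) = (0,0)` is real. -/
structure ModelTerm (d N' ν : ℕ) (Nf : Fin ν → ℕ) [∀ i, NeZero (Nf i)]
    (E : Type*) [NormedAddCommGroup E] [NormedSpace ℂ E] where
  Λ : Type
  [instFintype : Fintype Λ]
  [instDecEq : DecidableEq Λ]
  C₀ : Type
  locΛ : Λ → UT Nf
  locN : Λ ⊕ C₀ → UT Nf
  X : Finset (UT Nf)
  m : ℕ
  hfib : ∀ x : UT Nf, (Finset.univ.filter fun i => locΛ i = x).card ≤ m
  L : LocalTerms d N' ν Nf Λ (Λ ⊕ C₀) E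
  hreal : ∀ i j, (L.kernel 0 0 i j).im = 0

/-- The row index of a model term is a finite type (bundled instance, exposed). -/
instance ModelTerm.instFintypeΛ (t : ModelTerm d N' ν Nf E) : Fintype t.Λ := t.instFintype

/-- The row index of a model term has decidable equality (bundled instance, exposed). -/
instance ModelTerm.instDecEqΛ (t : ModelTerm d N' ν Nf E) : DecidableEq t.Λ := t.instDecEq

namespace ModelTerm

variable (c : B13.Consts) (t : ModelTerm d N' ν Nf E)

/-- The model `TermKernels` record: precision `A(σ,u) = 1`, covariance reference `C = 1 ≻ 0`, Γ-kernel `G(σ,u) = L.kernel σ u`,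
reference `Γ₀ = Re G(0,0)`. -/
def toKernels : TermKernels c d N' ν Nf E where
  Λ := t.Λ
  C₀ := t.C₀
  A2 := fun _ _ => 1
  G2 := t.L.kernel
  Γ₀ := (t.L.kernel 0 0).map Complex.re
  C := 1
  locΛ := t.locΛ
  locN := t.locN
  X := t.X
  m := t.m
  hfib := t.hfib
  hG0 := by
    ext i j
    simp only [Matrix.map_apply]
    apply Complex.ext
    · simp
    · simp [t.hreal i j]
  hC0 := by rw [inv_one, Matrix.map_one _ (map_zero _) (map_one _)]
  hC := Matrix.PosDef.one

/-! ## §2. `TermWalkData` for the model term: Γ-slot by `jointWalkExpansion_local`, the other two slots by the identity -/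

/-- One-term majorant families on `Unit`: partial sums are bounded by the single member. -/
private theorem majSumLe_unit {g : B6.Geometry} {K Kbar : g.Site → g.Site → ℝ} (hK : ∀ a b, 0 ≤ K a b)
    (hle : ∀ a b, K a b ≤ Kbar a b) : MajSumLe (fun (_ : Unit) a b => K a b) Kbar := by
  intro S a b
  calc ∑ _ω ∈ S, K a b ≤ ∑ _ω ∈ (Finset.univ : Finset Unit), K a b :=
        Finset.sum_le_sum_of_subset_of_nonneg (Finset.subset_univ S) fun _ _ _ => hK a b
    _ = K a b := by simp
    _ ≤ Kbar a b := hle a b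

/-- The identity's entries are bounded by `e^{−ρ·d₁(loc i, loc j)}` for any `ρ` (the diagonal sits at distance `0`). -/
private theorem one_apply_le {Λ : Type} [DecidableEq Λ] (locΛ : Λ → UT Nf) (ρ : ℝ) (i j : Λ) :
    ‖(1 : Matrix Λ Λ ℂ) i j‖ ≤ 1 * Real.exp (-(ρ * tdist1 Nf (locΛ i) (locΛ j))) := by
  by_cases h : i = j
  · subst h; simp [tdist1_self]
  · rw [Matrix.one_apply_ne h, norm_zero]; positivity

/-- The identity family `(σ,u) ↦ 1` is a one-term joint walk expansion at walk rate `κ + ε` with window `ε`, torus rate `κ`,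
constant `1`, walk distance `d₁`, empty σ-carrying sub-family (precision slot of the model term; any real `R, ε, κ`). -/
theorem jointWalkExpansion_one {Λ : Type} [Fintype Λ] [DecidableEq Λ] (locΛ : Λ → UT Nf) (X : Finset (UT Nf))
    (R ε κ : ℝ) :
    JointWalkExpansion c locΛ locΛ (fun (_ : TPt d N' → ℂ) (_ : E) => (1 : Matrix Λ Λ ℂ)) X R ε κ 1
      (fun (_ : Unit) (_ : TPt d N' → ℂ) (_ : E) => (1 : Matrix Λ Λ ℂ)) (∅ : Set Unit) (fun _ => 1)
      (fun _ => tdist1 Nf) (κ + ε) where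
  hasSum σ _ u _ i j := hasSum_unique (fun _ : Unit => (1 : Matrix Λ Λ ℂ) i j)
  termAnalytic _ σ _ i j := differentiableOn_const _
  maj _ σ _ u _ i j := one_apply_le locΛ (κ + ε) i j
  majSum := majSumLe_unit (fun a b => by positivity) (fun a b => by simp)
  indep _ _ σ _ := rfl
  through ω hω := by simp at hω
  A_nonneg _ := zero_le_one
  D_nonneg _ a b := tdist1_nonneg a b

omit [NormedSpace ℂ E] in
/-- The identity's covariance-slot triple `WalkMajorants` at rate `κ`, constant `1` (any real `R, κ`). -/
theorem walkMajorants_one_inv {Λ : Type} [Fintype Λ] [DecidableEq Λ] (locΛ : Λ → UT Nf) (R κ : ℝ) :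
    WalkMajorants c locΛ locΛ (fun (_ : TPt d N' → ℂ) (_ : E) => (1 : Matrix Λ Λ ℂ)⁻¹) R κ 1
      (fun (_ : Unit) (_ : TPt d N' → ℂ) (_ : E) => (1 : Matrix Λ Λ ℂ)⁻¹) (fun _ => 1) (fun _ => tdist1 Nf) κ where
  hasSum σ _ u _ i j := hasSum_unique (fun _ : Unit => (1 : Matrix Λ Λ ℂ)⁻¹ i j)
  maj _ σ _ u _ i j := by rw [inv_one]; exact one_apply_le locΛ κ i j
  majSum := majSumLe_unit (fun a b => by positivity) (fun a b => le_rfl)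
  A_nonneg _ := zero_le_one

variable {c t}

/-- **`TermWalkData` FOR THE MODEL TERM WITH A TORUS-UNIFORM PACKAGE.**  If the Γ-kernel datum is local (`IsLocal` with
letters `R, λ, r, m_J, n_B`; `λ, κ₁ ≥ 0`), the rates satisfy `0 ≤ ρ`, `0 ≤ κ`, `0 ≤ μ`, `κ + μ ≤ ρ − ε`, the row sum
(2.61) holds at rate `μ` with constant `c_μ` on this torus, and the row bonds are `R_σ`-far from `X`, then the model term
carries `TermWalkData` with the package `(R, ε, κ, K̄_Γ, 1, 1, R_σ)`, `K̄_Γ = λe^{κ₁m_J}e^{ρr}·n_B·c_μ` — no letter depends on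
the torus. -/
theorem termWalkData {R lam r : ℝ} {mJ nB : ℕ} (hL : t.L.IsLocal c t.locΛ t.locN t.X R lam r mJ nB)
    (hκ₁ : 0 ≤ c.κ₁) (hlam : 0 ≤ lam) {ρ ε κ μ cμ Rσ : ℝ} (hρ : 0 ≤ ρ) (hκ : 0 ≤ κ) (hμ : 0 ≤ μ)
    (hwin : κ + μ ≤ ρ - ε) (hrow : RowSum (toB6 (torusGeom Nf 0 0 0) 0 True) μ cμ)
    (hfar : ∀ b : t.Λ, ∀ z ∈ t.X, Rσ ≤ tdist1 Nf (t.locΛ b) z) :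
    TermWalkData (t.toKernels c)
      ⟨R, ε, κ, (lam * Real.exp (c.κ₁ * mJ) * Real.exp (ρ * r)) * (nB * cμ), 1, 1, Rσ⟩ where
  hΓ := ⟨t.L.B, t.L.term, t.L.sigmaCarrying, fun _ => lam * Real.exp (c.κ₁ * mJ) * Real.exp (ρ * r), t.L.dist, ρ,
    LocalTerms.jointWalkExpansion_local hL hκ₁ hlam hρ hκ hμ hwin hrow⟩
  hE := ⟨Unit, fun _ _ _ => 1, ∅, fun _ => 1, fun _ => tdist1 Nf, κ + ε, jointWalkExpansion_one c t.locΛ t.X R ε κ⟩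
  hCov := ⟨Unit, fun _ _ _ => (1 : Matrix t.Λ t.Λ ℂ)⁻¹, fun _ => 1, fun _ => tdist1 Nf, κ, walkMajorants_one_inv c t.locΛ R κ⟩
  hfar := hfar

end ModelTerm

end Model

/-! ## §3. ACROSS an exhausting family of tori: (v)⁺ with ONE package -/

section Across

variable {d : ℕ}

/-- MODEL MEMBER of an exhausting family (Type-valued, nothing asserted): its own torus (`N'`, `ν`, `Nf`), configuration space
`E`, index of terms `ι`, and a model term datum for each term. -/
structure ModelMember (d : ℕ) where
  N' : ℕ
  ν : ℕ
  Nf : Fin ν → ℕ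
  [instNf : ∀ i, NeZero (Nf i)]
  E : Type
  [instE₁ : NormedAddCommGroup E]
  [instE₂ : NormedSpace ℂ E]
  ι : Type
  t : ι → ModelTerm d N' ν Nf E

/-- The member's torus side lengths are non-zero (bundled instance, exposed). -/
instance ModelMember.instNeZeroNf (M : ModelMember d) (i : Fin M.ν) : NeZero (M.Nf i) := M.instNf i

/-- The member's configuration space is a normed group (bundled instance, exposed). -/
instance ModelMember.instNormedAddCommGroupE (M : ModelMember d) : NormedAddCommGroup M.E := M.instE₁

/-- The member's configuration space is a complex normed space (bundled instance, exposed). -/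
instance ModelMember.instNormedSpaceE (M : ModelMember d) : NormedSpace ℂ M.E := M.instE₂

/-- The member as a `TorusTerms` record (the bundled index of `ExistsUniformAcross(Small)`). -/
def ModelMember.toTorusTerms (c : B13.Consts) (M : ModelMember d) : TorusTerms c d where
  N' := M.N'
  ν := M.ν
  Nf := M.Nf
  E := M.E
  ι := M.ι
  𝒦 := fun i => (M.t i).toKernels c

variable {c : B13.Consts}

/-- **(v)⁺ ACROSS THE FAMILY — `ExistsUniformAcrossSmall` INHABITED with a torus-uniform package.**  For ANY index `S` of model
members: if every term's Γ-datum is local with the SAME letters `(R, λ, r, m_J, n_B)`, every member's torus satisfies the row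
sum (2.61) at rate `μ` with the SAME constant `c_μ`, every term's row bonds are `Rσ₀`-far from its σ-region, and the numerics
hold — `0 ≤ λ`, `0 ≤ κ₁`, `0 ≤ ρ`, `0 ≤ ε`, `0 < κ`, `0 ≤ μ`, `κ + μ ≤ ρ − ε`, `0 ≤ α < R`, and the SMALLNESS
`2·max(K̄_Γ, 1)·(e^{−εRσ₀} + α∕R) ≤ θ₀` with `K̄_Γ = λe^{κ₁m_J}e^{ρr}·n_B·c_μ` — then ONE package
`w = (R, ε, κ, K̄_Γ, 1, 1, Rσ₀)` is admissible, SMALL, and serves every member and term: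
`ExistsUniformAcrossSmall (fun s => (𝓜 s).toTorusTerms c) α Rσ₀ θ₀` (via g1-plan-1's `acrossSmall_of_decay`).  The first
inhabitant of the row-(D4) first-missing-lemma SHAPE beyond the free term, with smallness from decay letters; nothing about
Bałaban's kernels. -/
theorem acrossSmall_model {S : Type*} (𝓜 : S → ModelMember d) {R lam r : ℝ} {mJ nB : ℕ}
    {ρ ε κ μ cμ Rσ₀ α θ₀ : ℝ}
    (hloc : ∀ s (i : (𝓜 s).ι), ((𝓜 s).t i).L.IsLocal c ((𝓜 s).t i).locΛ ((𝓜 s).t i).locN ((𝓜 s).t i).X R lam r mJ nB)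
    (hrow : ∀ s, RowSum (toB6 (torusGeom (𝓜 s).Nf 0 0 0) 0 True) μ cμ)
    (hfar : ∀ s (i : (𝓜 s).ι) (b : ((𝓜 s).t i).Λ), ∀ z ∈ ((𝓜 s).t i).X, Rσ₀ ≤ tdist1 (𝓜 s).Nf (((𝓜 s).t i).locΛ b) z)
    (hκ₁ : 0 ≤ c.κ₁) (hlam : 0 ≤ lam) (hρ : 0 ≤ ρ) (hε : 0 ≤ ε) (hκ : 0 < κ) (hμ : 0 ≤ μ) (hwin : κ + μ ≤ ρ - ε)
    (hcμ : 0 ≤ cμ) (hα : 0 ≤ α) (hαR : α < R)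
    (hθ : 2 * max ((lam * Real.exp (c.κ₁ * mJ) * Real.exp (ρ * r)) * (nB * cμ)) 1 * (Real.exp (-(ε * Rσ₀)) + α / R) ≤ θ₀) :
    ExistsUniformAcrossSmall (fun s => (𝓜 s).toTorusTerms c) α Rσ₀ θ₀ := by
  have hK : 0 ≤ (lam * Real.exp (c.κ₁ * mJ) * Real.exp (ρ * r)) * (nB * cμ) := by positivity
  refine acrossSmall_of_decay ⟨R, ε, κ, (lam * Real.exp (c.κ₁ * mJ) * Real.exp (ρ * r)) * (nB * cμ), 1, 1, Rσ₀⟩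
    ⟨hαR, hε, hκ, hK, zero_le_one, zero_le_one, le_rfl⟩ (fun s i => ?_) (le_max_left _ _) (le_max_right _ _) hα hθ
  exact ModelTerm.termWalkData (hloc s i) hκ₁ hlam hρ hκ.le hμ hwin (hrow s) (hfar s i)

/-- **(v)⁺ ACROSS ALL TORI OF DIMENSION `≤ d_m`, row sum DISCHARGED**: with `μ > 0` and `c_μ := c₀(1,μ)^{d_m}`
(`B13LocalKernelWalks.rowSum_torus_of_le`, [B6] Lemma 2.1 at one scale) the hypothesis `hrow` of `acrossSmall_model` holds
for every member whose torus has dimension `ν ≤ d_m` — e.g. every four-torus `(ℤ∕N₁) × ⋯ × (ℤ∕N₄)` of Bałaban's exhausting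
sequence. -/
theorem acrossSmall_model_dim {S : Type*} (𝓜 : S → ModelMember d) {dm : ℕ} (hdim : ∀ s, (𝓜 s).ν ≤ dm)
    {R lam r : ℝ} {mJ nB : ℕ} {ρ ε κ μ Rσ₀ α θ₀ : ℝ}
    (hloc : ∀ s (i : (𝓜 s).ι), ((𝓜 s).t i).L.IsLocal c ((𝓜 s).t i).locΛ ((𝓜 s).t i).locN ((𝓜 s).t i).X R lam r mJ nB)
    (hfar : ∀ s (i : (𝓜 s).ι) (b : ((𝓜 s).t i).Λ), ∀ z ∈ ((𝓜 s).t i).X, Rσ₀ ≤ tdist1 (𝓜 s).Nf (((𝓜 s).t i).locΛ b) z)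
    (hκ₁ : 0 ≤ c.κ₁) (hlam : 0 ≤ lam) (hρ : 0 ≤ ρ) (hε : 0 ≤ ε) (hκ : 0 < κ) (hμ : 0 < μ) (hwin : κ + μ ≤ ρ - ε)
    (hα : 0 ≤ α) (hαR : α < R)
    (hθ : 2 * max ((lam * Real.exp (c.κ₁ * mJ) * Real.exp (ρ * r)) * (nB * B6.c0 1 μ ^ dm)) 1
      * (Real.exp (-(ε * Rσ₀)) + α / R) ≤ θ₀) :
    ExistsUniformAcrossSmall (fun s => (𝓜 s).toTorusTerms c) α Rσ₀ θ₀ :=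
  acrossSmall_model 𝓜 hloc (fun s => B13LocalKernelWalks.rowSum_torus_of_le (𝓜 s).Nf hμ (hdim s)) hfar
    hκ₁ hlam hρ hε hκ hμ.le hwin (pow_nonneg (B6RandomWalk.c0_nonneg 1 μ) dm) hα hαR hθ

/-- **THE σ-ADMISSIBLE REGION, located** (g1-plan-1 L-1): the σ-part of the threshold for the model package is
`2K̄_Γ·e^{−εRσ₀} = 2(λe^{κ₁m_J}·n_B·c_μ)·e^{ρr − εRσ₀}` — small only when `εRσ₀` exceeds `ρr` (plus `log` of the prefactor):
the σ-region must be farther from the row bonds than the range `r` by the factor `ρ∕ε` (print: `dist(X, Z₀) > ⅔M ≫ range`,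
[II] p. 13); the `α∕R` summand is independent of it. -/
theorem kbar_sigma_part (c : B13.Consts) (lam r cμ ρ ε Rσ₀ : ℝ) (mJ nB : ℕ) :
    2 * ((lam * Real.exp (c.κ₁ * mJ) * Real.exp (ρ * r)) * (nB * cμ)) * Real.exp (-(ε * Rσ₀))
      = 2 * (lam * Real.exp (c.κ₁ * mJ) * (nB * cμ)) * Real.exp (ρ * r - ε * Rσ₀) := by
  rw [sub_eq_add_neg, Real.exp_add]; ring

end Across

end Summit.QuantumFields.BalabanUV.Gaps.D4WalkModelAcross

end
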